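import Summits.BirchSwinnertonDyer.BirchSwinnertonDyer.Theses.TwoAdicConverse
import Summits.BirchSwinnertonDyer.BirchSwinnertonDyer.Theorems.TwoAdicConverseMultLambdaWallsDescent
import HarnessLib

/-!
# LINE `cycint` (v5) for crux `MultTwoConverseOverKAtTwo` (item stmt-BirchSwinnertonDyer-19187), route `TwoAdicConverse`

Reshape (seat bsd-2adic-conv-2 GEN 13, 2026-08-27) of the v4 skeleton (GEN 12, tree `Lines/cycint.lean` commit 74290e710e2e; stubs
`stub_pub`, `stub_pubKato`, `stub_lamNonsplitFinSel`, `stub_eisSplitFinSel`). ONE CHANGE, SPLIT sign only — the trigger recorded by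
GEN 12 («K11b split package PRINT-located ⇒ the split wall in `λ`-form», census R-GEN12-3) has fired: seat bsd-2adic-mult GEN 11
landed `Literature/…/Kato2004/DivisibilityInputsMultiplicativeDescentSplit.lean` (p495896) — the construction fact
`Kato2004.exists_multDivisibilityInputsDescent_split` (Kato §§12–17 over `ℚ_p(ζ_{p^∞})` at `T″(k−1) = ℤ_p`, `Δ`-descent; every field
print-located or a labelled prime-independent bridge; EVERY `p`) with the kernel theorem `Kato2004.katoDivisibility_splitMult_of_descentSplitFacts`
(`X` torsion, `ι(T·g) = 2^m·L₂`, `g ∈ char_Λ X`). So Kato's `⊗ℚ` divisibility at a SPLIT multiplicative `2` (K11b-Rat) is a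
KERNEL theorem modulo PRINT-located inputs only (`MultLambdaWall.katoRatSplit_two_of_descentSplit`, this seat, file
`Theorems/TwoAdicConverseMultLambdaWallsDescent.lean`), exactly as K11a was for v4, and the split road switches from the
integral-Eisenstein-up-to-isogeny road (`MultSplitWeakEZ.splitMultRankZeroTwoConverse_of_wallS3_of_weakEZ`) to the `λ`-ROAD
(`MultLambdaWall.splitMultRankZeroTwoConverse_of_lamWallSplit_of_katoRat`, file `Theorems/TwoAdicConverseMultLambdaWallSplit.lean`,
p496603). The research stub `stub_eisSplitFinSel` (INTEGRAL Eisenstein divisibility `X5.O1.MultEisensteinDivisibilityAtTwo` — Néron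
period, `μ`-sensitive — at SOME isogenous minimal member) is REPLACED by the weaker-shaped

* `stub_lamSplitFinSel` — λ-WALL-sp (research): for every non-CM globally minimal `W` SPLIT multiplicative at `2` with
  `corank_{ℤ₂} Sel_{2^∞}(W/ℚ) = 0`, every cyclotomic datum, newform `f` of `W`, dual datum `D` with `char_Λ X = (g)` and every
  `h ∈ Λ`, `n` with `ι(T·g·h) = 2ⁿ·L₂(f)` (`IsSplitMultPAdicLFunctionOf f 2 L₂`, trivial zero charged to `T`): `g·h ≠ 0 ∧ λ(g·h) ≤ λ(g)`
  («`λ_an ≤ λ_alg + 1`» AT `W`: no `μ`, no period, no isogeny hedge, no Greenberg–Stevens). Implied by the member-wise integral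
  wall on the same locus and by v4's isogeny-hedged stub modulo K11 at the isogenous member (kernel:
  `MultLambdaWall.multLambdaPartSplit_of_multEisenstein`, `MultLambdaWall.lamWallSplit_of_wallS3Split_of_katoRat`, file
  `Theorems/TwoAdicConverseMultLambdaWallSplitIsogeny.lean`).

The other stubs: `stub_pub`, `stub_pubKato`, `stub_lamNonsplitFinSel` UNCHANGED (byte-identical to v4); NEW PRINT-located stub
`stub_pubKatoSplit` = the split descent fact. Composition: `Theorems.MultLambdaWall.multTwoConverseOverKAtTwo_of_lamWalls_of_descents`
(this seat, GEN 13). Five stubs: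

* `stub_pub` — PRINT (v3/v4 verbatim): `MultConversePublishedInputsAtTwo` ∧ A235-twin ∧ A236 ∧ modular parametrisation ∧ Greenberg
  Thm. 1.5 ∧ Spieß 2014 Thm. 5.7 at every split-at-`2` curve.
* `stub_pubKato` — PRINT-located (v4 verbatim): `Kato2004.nonempty_iwasawaH1Data ∧ Kato2004.thm12_4 ∧
  Kato2004.exists_multDivisibilityInputsDescent_nonsplit` (audit sheets h12@2 / H2@2 / K11-inputs ADD-3 on file).
* `stub_pubKatoSplit` — PRINT-located (NEW): `Kato2004.exists_multDivisibilityInputsDescent_split` (p495896; audit sheet to be asked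
  of the D-audit lane by the mult lane, the non-split ADD-3 being the template).
* `stub_lamNonsplitFinSel` — WALL (research; v4 verbatim).
* `stub_lamSplitFinSel` — WALL (research; NEW shape).
So the research content of 19187 (≡ 19219 mod PUB) is: λ-WALL-ns ∧ λ-WALL-sp — for BOTH signs «`λ_an ≤ λ_alg` (+1 at a split `2`)
on the finite-`Sel` locus», `μ`-free, period-free, isogeny-free. Not in print at `p = 2` either way.
-/

set_option autoImplicit false
set_option linter.dupNamespace false

noncomputable section

open WeierstrassCurve Literature.NumberTheory.EllipticCurves
  Literature.NumberTheory.EllipticCurves.ModularForms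
  Literature.NumberTheory.EllipticCurves.Greenberg1999
  Literature.NumberTheory.EllipticCurves.Spiess2014
  Literature.NumberTheory.EllipticCurves.Rank1Residual
  Summit.BirchSwinnertonDyer.Rank1Residual.X1.MuLambda
  Summit.BirchSwinnertonDyer.Rank1Residual.X5
  Summit.BirchSwinnertonDyer.BirchSwinnertonDyer.Theses.TwoAdicConverse

namespace Summit.BirchSwinnertonDyer.BirchSwinnertonDyer.Cruxes.MultTwoConverseOverKAtTwo.CycInt

/-- PUB stub (v3 VERBATIM): the published inputs of the cyclotomic road (named tree facts; displayed, never progress),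
including Spieß 2014 Thm. 5.7 (weak exceptional-zero vanishing) at every split-at-`2` curve.
[cite: Kato2004Asterisque, Cor. 14.3 (p. 235)] [cite: GreenbergLNM1716, §4 pp. 112–113 and Thm. 1.5 (p. 61)]
[cite: BCDTJAMS2001, Thm. A] [cite: Spiess2014Invent, Thm. 5.7 (F = ℚ, r = 1)] -/
theorem stub_pub :
    MultConversePublishedInputsAtTwo ∧ thm41Analogue_charValue_rankZero_numberField_anyPrime_oddLocalDegree ∧
      thm41Analogue_charValue_rankZero_split_baseChange_anyPrime ∧ nonempty_modularParametrizationData ∧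
        thm15_isTorsion_multiplicative_rat ∧
          (∀ (W : WeierstrassCurve ℚ) [W.IsElliptic] [W.IsGloballyMinimal],
            W.HasSplitMultiplicativeReductionAtPrime 2 → thm57_weakExceptionalZero_splitMultiplicative_rat W 2) := by
  sorry

/-- PUB stub (NEW in v4, PRINT-located): the three Literature inputs of the K11a kernel at a non-split multiplicative `2`
— Kato's `𝐇¹` construction on the `ℤ₂`-tower, Thm. 12.4, and the descended divisibility package (§§12–17 over
`ℚ₂(ζ_{2^∞})`, Lemma 17.12 verbatim at `ℤ₂(φ)`, `Δ`-descent). Displayed, never progress; audit sheets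
D-AUDIT-h12at2 @4e2b48addd282a22, D-AUDIT-H2at2 @09a64247034a921e, D-AUDIT-K11inputs ADDENDUM-3 @92b1d91d483ea390.
[cite: Kato2004Asterisque, Thm. 12.4 (p. 219), Prop. 17.11 / Lemma 17.12 (pp. 277–279), §17.13 (pp. 279–280)] -/
theorem stub_pubKato :
    Kato2004.nonempty_iwasawaH1Data ∧ Kato2004.thm12_4 ∧ Kato2004.exists_multDivisibilityInputsDescent_nonsplit := by
  sorry

/-- PUB stub (NEW in v5, PRINT-located): the Literature input of the K11b-Rat kernel at a split multiplicative `2` — Kato's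
§§12–17 over `ℚ₂(ζ_{2^∞})` read at `T″(k−1) = ℤ₂` with the `Δ = {±1}`-descent, the descended Coleman map valued in `(T)`
(file `Literature/…/Kato2004/DivisibilityInputsMultiplicativeDescentSplit.lean`, seat bsd-2adic-mult GEN 11, p495896). Displayed,
never progress. [cite: Kato2004Asterisque, 12.1 (pp. 219–220), Thm. 12.4–12.6 (pp. 221–222), Thm. 16.4 (pp. 268–271), Prop. 17.11 / Lemma 17.12 and (17.12.1) (pp. 277–279), §17.13 (pp. 279–280)]
[cite: GreenbergLNM1716, §2 (split multiplicative v: Im κ = Im λ)] -/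
theorem stub_pubKatoSplit : Kato2004.exists_multDivisibilityInputsDescent_split := by
  sorry

/-- WALL (research, hardest), NON-SPLIT sign, finite-`Sel` locus, `λ`-FORM (v4 VERBATIM; replaced v3's
`stub_eisNonsplitFinSel`): for every non-CM globally minimal `W` non-split multiplicative at `2` with
`corank_{ℤ₂} Sel_{2^∞}(W/ℚ) = 0`, every cyclotomic datum `(κ, γ)`, newform `f` of `W`, dual datum `D` with `char_Λ X = (g)`,
every `h ∈ Λ` and `n` with `ι(g·h) = 2ⁿ·L₂(f,−1)`: `g·h ≠ 0` and `λ(g·h) ≤ λ(g)` — «`λ_an(W) ≤ λ_alg(W)`», `μ`-free,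
period-free, no isogeny hedge (exactly the non-split conjunct of the `λ`-part binder of p419187, restricted to the
finite-`Sel` locus). Not in print at `p = 2` (Greenberg–Vatsal 2000 and the Eisenstein-congruence arguments keep `p` odd).
[cite: GreenbergVatsal2000, p. 4 (after Thm. (1.2)) (shape; p odd)] [cite: Skinner2016PacificMC, Thm. A and Thm. B (shape; p ≥ 3)] -/
theorem stub_lamNonsplitFinSel :
    ∀ (W : WeierstrassCurve ℚ) [W.IsElliptic] [W.IsGloballyMinimal], ¬ W.HasCM → Mult W 2 →
      ¬ W.HasSplitMultiplicativeReductionAtPrime 2 → W.selmerCorank 2 = 0 →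
      ∀ (κ : ZpExtension ℚ 2) (γ : Field.absoluteGaloisGroup ℚ), κ.IsCyclotomic →
      κ.IsTopGenerator γ → IsCyclotomicVariable 2 γ →
      ∀ ⦃N : ℕ⦄ [NeZero N] (f : CuspForm (CongruenceSubgroup.Gamma0 N) 2), IsNewformOf W f →
      ∀ (D : W.SelmerDualData κ γ) (g h : IwasawaAlgebra 2) (n : ℕ), D.charIdeal = Ideal.span {g} →
      ∀ L : PowerSeries ℚ_[2], IsMultPAdicLFunctionOf f 2 (-1) L →
        iwasawaToPowerSeries 2 (g * h) = PowerSeries.C ((2 : ℚ_[2]) ^ n) * L →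
        g * h ≠ 0 ∧ lam (g * h) ≤ lam g := by
  sorry

/-- WALL (research), SPLIT sign, finite-`Sel` locus, `λ`-FORM (NEW in v5, replaces v3/v4's `stub_eisSplitFinSel`): for every
non-CM globally minimal `W` SPLIT multiplicative at `2` with `corank_{ℤ₂} Sel_{2^∞}(W/ℚ) = 0`, every cyclotomic datum `(κ, γ)`,
newform `f` of `W`, dual datum `D` with `char_Λ X = (g)`, every `h ∈ Λ` and `n` with `ι(T·g·h) = 2ⁿ·L₂(f)` (the split MTT function,
`L₂(0) = 0`, trivial zero charged to `T`): `g·h ≠ 0` and `λ(g·h) ≤ λ(g)` — «`λ_an(W) ≤ λ_alg(W) + 1`», `μ`-free, period-free, no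
isogeny hedge, no Greenberg–Stevens (exactly the split conjunct of the `λ`-part binder of p419187, restricted to the finite-`Sel`
locus). Not in print at `p = 2` (Skinner 2016 keeps `p ≥ 3`; Greenberg–Vatsal 2000 keeps `p` odd; the split `2` carries the
exceptional zero on top). [cite: Skinner2016PacificMC, Thm. A and Thm. B (shape; p ≥ 3)] [cite: GreenbergVatsal2000, p. 4 (after Thm. (1.2)) (shape; p odd)]
[cite: GreenbergLNM1716, §4 pp. 112–113] -/
theorem stub_lamSplitFinSel :
    ∀ (W : WeierstrassCurve ℚ) [W.IsElliptic] [W.IsGloballyMinimal], ¬ W.HasCM → Mult W 2 →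
      W.HasSplitMultiplicativeReductionAtPrime 2 → W.selmerCorank 2 = 0 →
      ∀ (κ : ZpExtension ℚ 2) (γ : Field.absoluteGaloisGroup ℚ), κ.IsCyclotomic →
      κ.IsTopGenerator γ → IsCyclotomicVariable 2 γ →
      ∀ ⦃N : ℕ⦄ [NeZero N] (f : CuspForm (CongruenceSubgroup.Gamma0 N) 2), IsNewformOf W f →
      ∀ (D : W.SelmerDualData κ γ) (g h : IwasawaAlgebra 2) (n : ℕ), D.charIdeal = Ideal.span {g} →
      ∀ L : PowerSeries ℚ_[2], IsSplitMultPAdicLFunctionOf f 2 L →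
        iwasawaToPowerSeries 2 (PowerSeries.X * (g * h)) = PowerSeries.C ((2 : ℚ_[2]) ^ n) * L →
        g * h ≠ 0 ∧ lam (g * h) ≤ lam g := by
  sorry

/-- The crux `MultTwoConverseOverKAtTwo` (item 19187) BY NAME from the five stubs:
`Theorems.MultLambdaWall.multTwoConverseOverKAtTwo_of_lamWalls_of_descents` (seat bsd-2adic-conv-2 GEN 13) = the non-split `λ`-road on
the K11a kernel ∧ the split `λ`-road on the K11b-Rat kernel (Spieß-keyed) ∘ `19219 ⟹ 19187` mod PUB (p418586).
[cite: Kato2004Asterisque, §17.13 (pp. 279–280) and Cor. 14.3 (p. 235)] [cite: Spiess2014Invent, Thm. 5.7]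
[cite: GreenbergLNM1716, §4 pp. 112–113 and Thm. 1.5 (p. 61)] -/
theorem MultTwoConverseOverKAtTwo_of :
    Summit.BirchSwinnertonDyer.BirchSwinnertonDyer.Theses.TwoAdicConverse.MultTwoConverseOverKAtTwo :=
  Summit.BirchSwinnertonDyer.BirchSwinnertonDyer.Theorems.MultLambdaWall.multTwoConverseOverKAtTwo_of_lamWalls_of_descents
    stub_pub.1 stub_pub.2.1 stub_pub.2.2.1 stub_pub.2.2.2.1 stub_pub.2.2.2.2.1
    stub_pubKato.1 stub_pubKato.2.1 stub_pubKato.2.2 stub_pubKatoSplit stub_pub.2.2.2.2.2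
    stub_lamNonsplitFinSel stub_lamSplitFinSel

end Summit.BirchSwinnertonDyer.BirchSwinnertonDyer.Cruxes.MultTwoConverseOverKAtTwo.CycInt

end
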